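/-
Copyright (c) 2026 the pub-hodgecm-mathlib formalisation cell (harness21).  Prover seat hodgecm-mathlib-K2E3-p26 (g0), Track B «K2-LIT» ∕ h413
(`stmt-HodgeConjecture-24833`), line `K2_E3_EllipticInputs`, PART «RANK» leaf (qs2-res) `sig_K2E3CharLocIntNearIdentityResidualQuasiSplitTwo`, deal D121 (St-PIN₂):
THE JACQUET FILTRATION AND THE «NO 3-CHAIN» LETTER OF THE PRINCIPAL SERIES OF `U(Φ₂)(L⁺_v)`, FOR EVERY CHARACTER OF THE TORUS.  2026-09-04.
-/
import Summits.HodgeConjecture.HodgeConjecture.Theorems.K2E3QuasiSplitTwoTorusDefs               -- ★ D115 (this seat): `torusChart₂`, `torusChartHom₂`, `torusChart₂_torusCoords₂`, `continuous_torusChart₂`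
import Summits.HodgeConjecture.HodgeConjecture.Theorems.F0P3cU2PrincipalSeriesJacquetFiltration   -- ★ (N1)₂ `u2PrincipalSeries_jacquetFiltration` (Casselman 7.1.1 (a) for `U(1,1)`, pair characters)
import Summits.HodgeConjecture.HodgeConjecture.Theorems.F0P3bU2PrincipalSeriesJacquetRankLeTwo    -- ★ `finiteDimensional_finrank_coinvariants_cmPrincipalSeries_two_le_two` (every `χ`)
import Summits.HodgeConjecture.HodgeConjecture.Theorems.F0P3bHPrincipalSeriesJHHolds              -- ★ (H3)₂ `hHC_holds` (every constituent of `i_G(χ)` has `r_B ≠ 0`, every `χ`)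
import Summits.HodgeConjecture.HodgeConjecture.Theorems.K2E3LocalIrrepCuspidalOrPrincipalTwo       -- ★ p860637 (K2E3-p27 (g0)): `isSmooth_cmPrincipalSeries` (every `N`)
import Literature.NumberTheory.Automorphic.JacquetRankStrictMono                                  -- ★ `Representation.not_bot_lt_lt_lt_top_of_finrank_coinvariants_le_two`, `…finrank_coinvariants_eq_one_of_ne_bot_of_ne_top`
import Literature.NumberTheory.Automorphic.UnitaryGroupUnipotentLimitCompactOpen                  -- ★ `isLimitOfCompactOpen_cmBorelTriple_N` (every `N`)
import HarnessLib

/-!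
# K2_E3 road (h413), PART «RANK», leaf (qs2-res) — (St-PIN₂): the principal series `i_G(χ)` of `U(Φ₂)(L⁺_v)` (non-split `v`) has a TWO-dimensional Jacquet
# module with exponents `χ`, `wχ`, every constituent has `r_B ≠ 0`, and there is NO chain `⊥ < N₁ < N₂ < ⊤` of subrepresentations

Cell `pub/hodgecm-mathlib` (D-0151), Track B, seat K2E3-p26 (g0), dealer K2E3-plan (g4) deal D121 (cut (res-cut) ∕ (res-St) ∕ (res-ω) of the hosted leaf (qs2-res),
`K2/STATUS.md` 2026-09-04T13:52:08Z); feeds (res-cut) AND (res-St).  `--supports stmt-HodgeConjecture-24833 --as helper`; THEOREMS ONLY (no definition ∕ instance ∕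
notation ∕ named fact ∕ `sorry`); never imports `Cruxes/…/Lines`.  COUNT-NEUTRAL.  PURE ASSEMBLY of ★ Track A capital on `U(1,1)` («H»-road, F0 P3b∕c):
* ★ (N1)₂ `F0P3cU2PrincipalSeriesJacquetFiltration.u2PrincipalSeries_jacquetFiltration` — for PAIR characters `torusCharPair σ Φ₂ _ 0 χ₁ χ₂` with `χ₁, χ₂` continuous:
  `r_{B₂} i_G(χ)` is finite-dimensional of dimension `2`, with a LINE `ℓ` on which `T₂` acts by `wχ = weylTorusCharPair … 0 χ₁ χ₂` and modulo which it acts by `χ`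
  [Casselman1995, Lemma 7.1.1 (a)]; EVERY character `χ` of `T₂ ≅ E_wˣ` is such a pair character, `χ = torusCharPair … 0 (χ ∘ ι₂) 1` (§1, through the ★ D115 chart
  `torusChart₂ : E_wˣ → T₂` and `torusChart₂_torusCoords₂`), and then `wχ(t) = χ(ι₂(d₁(t))) = χ(w₀ t w₀⁻¹)` (§1);
* ★ (H3)₂ `F0P3bHPrincipalSeriesJHHolds.hHC_holds` — every irreducible constituent of `i_G(χ)` has a representative with non-trivial Jacquet module (Harish-Chandra's
  criterion ★ (HC₂) + projectivity of supercuspidals), EVERY `χ`;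
* ★ `F0P3bU2PrincipalSeriesJacquetRankLeTwo.finiteDimensional_finrank_coinvariants_cmPrincipalSeries_two_le_two` — `dim r_{B₂} i_G(χ) ≤ 2`, EVERY `χ` (no continuity);
* ★ `Representation.not_bot_lt_lt_lt_top_of_finrank_coinvariants_le_two` ∕ `…finrank_coinvariants_eq_one_of_ne_bot_of_ne_top` (★ `JacquetRankStrictMono`: the Jacquet rank
  is STRICTLY monotone along chains when every constituent has `r ≠ 0`) with ★ `isLimitOfCompactOpen_cmBorelTriple_N` and ★ `isSmooth_cmPrincipalSeries`.

* §1 `torusCharPair_comp_torusChartHom₂_eq`, `weylTorusCharPair_comp_torusChartHom₂_apply`, `continuous_comp_torusChartHom₂`;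
* §2 **`not_bot_lt_lt_lt_top_cmPrincipalSeries_two`** (every `χ`), **`finrank_restrict_eq_one_of_ne_bot_of_ne_top_two`** (continuous `χ`);
* §3 **`jacquetFiltration_cmPrincipalSeries_two`** (★ (N1)₂ for an arbitrary continuous `χ`).

HONEST LABEL: HC_CM is proved only modulo the 7 printed citations (2 remaining named inputs: hLiu418 = stmt-HodgeConjecture-24832, h413 =
stmt-HodgeConjecture-24833) until rung 0 closes; count-neutral helper (structure letters for the (qs2-res) cut; no character estimate is proved here).

## References
* [Casselman1995] W. Casselman, *Introduction to the theory of admissible representations of 𝔭-adic reductive groups* (1995), Lemma 7.1.1 (a), Cor. 7.1.2, Prop. 7.1.3 p. 67; §6.3.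
* [BernsteinZelevinsky1977] I. N. Bernstein, A. V. Zelevinsky, *Induced representations of reductive 𝔭-adic groups I*, Ann. Sci. ÉNS 10 (1977), §2.12, Cor. 2.13 (c), Thm. 2.8.
* [Rogawski1990] J. D. Rogawski, *Automorphic Representations of Unitary Groups in Three Variables*, Ann. of Math. Stud. 123 (1990), §12.1 pp. 171–172, §12.2 p. 173.
-/

set_option autoImplicit false
set_option linter.dupNamespace false

noncomputable section

open NumberField IsDedekindDomain MeasureTheory Topology Module
open scoped Matrix MatrixGroups NNReal
open Literature.NumberTheory.Rogawski1990 Literature.NumberTheory.Automorphic Literature.NumberTheory.Automorphic.UnitaryGroup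
open Summit.HodgeConjecture.HodgeConjecture.Cruxes.H413.K2E3QuasiSplitTwoTorusDefs

namespace Summit.HodgeConjecture.HodgeConjecture.Cruxes.H413.K2E3U2PrincipalSeriesNoThreeChain

variable (L : Type) [Field L] [NumberField L] [IsCMField L] (v : HeightOneSpectrum (𝓞 ↥(maximalRealSubfield L)))

/-! ## §1 Every character of `T₂` is a pair character through the chart `ι₂` -/

/-- **`χ = (χ ∘ ι₂, 1)`**: every character `χ` of the diagonal torus `T₂` of `U(Φ₂)(L⁺_v)` is the PAIR character `torusCharPair … 0 (χ ∘ ι₂) 1` (coordinate `0`, trivial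
`E¹`-component) — `t = ι₂(d₀(t))` by ★ D115 `torusChart₂_torusCoords₂`. [cite: Rogawski1990, §12.1 p. 171; §12.2 p. 173] -/
theorem torusCharPair_comp_torusChartHom₂_eq (χ : ↥(cmBorelTriple L 2 v).M →* ℂˣ) :
    torusCharPair (conjLocal L (IsCMField.complexConj L) v) (cmLocalForm L 2 v) (cmLocalForm_eq_over L 2 v) 0 (χ.comp (torusChartHom₂ L v)) 1 = χ := by
  refine MonoidHom.ext fun t => ?_
  rw [torusCharPair_apply, MonoidHom.one_apply, mul_one, MonoidHom.comp_apply, torusChartHom₂_apply]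
  exact congrArg χ (torusChart₂_torusCoords₂ L v t)

/-- `χ ∘ ι₂` has continuous value when `χ` has (★ D115 `continuous_torusChart₂`). [cite: Rogawski1990, §12.2 p. 173] -/
theorem continuous_comp_torusChartHom₂ (χ : ↥(cmBorelTriple L 2 v).M →* ℂˣ) (hχ : Continuous fun t => ((χ t : ℂˣ) : ℂ)) :
    Continuous fun a : (LocalRing L v)ˣ => (((χ.comp (torusChartHom₂ L v)) a : ℂˣ) : ℂ) :=
  hχ.comp (continuous_torusChart₂ L v)

set_option maxHeartbeats 400000 in
/-- **The Weyl-conjugate exponent read through the chart**: `w(χ ∘ ι₂, 1)(t) = χ(ι₂(d₁(t)))` (`= χ(w₀ t w₀⁻¹)`, `w₀` the antidiagonal Weyl element: on `T₂`,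
`d₁ = σ(d₀)⁻¹`, ★ D115 `torusEntry_one_torusChart₂`). [cite: Rogawski1990, §12.2 p. 173] -/
theorem weylTorusCharPair_comp_torusChartHom₂_apply (χ : ↥(cmBorelTriple L 2 v).M →* ℂˣ) (t : ↥(cmBorelTriple L 2 v).M) :
    weylTorusCharPair (conjLocal L (IsCMField.complexConj L) v) (cmLocalForm L 2 v) (cmLocalForm_eq_over L 2 v) 0 (χ.comp (torusChartHom₂ L v)) 1 t =
      χ (torusChart₂ L v (torusEntry (conjLocal L (IsCMField.complexConj L) v) (cmLocalForm L 2 v) 1 t)) := by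
  -- `d₁(t) = σ(d₀(t))⁻¹`: read on `t = ι₂(d₀(t))`
  have key : (Units.map ((conjLocal L (IsCMField.complexConj L) v : LocalRing L v →+* LocalRing L v) : LocalRing L v →* LocalRing L v)
      (torusEntry (conjLocal L (IsCMField.complexConj L) v) (cmLocalForm L 2 v) 0 t))⁻¹ =
      torusEntry (conjLocal L (IsCMField.complexConj L) v) (cmLocalForm L 2 v) 1 t := by
    conv_rhs => rw [← torusChart₂_torusCoords₂ L v t]
    rw [torusCoords₂_apply, torusEntry_one_torusChart₂]
  rw [weylTorusCharPair_apply, MonoidHom.one_apply, mul_one, ← MonoidHom.map_inv (χ.comp (torusChartHom₂ L v)), key, MonoidHom.comp_apply,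
    torusChartHom₂_apply]

/-! ## §2 No chain `⊥ < N₁ < N₂ < ⊤` in `i_G(χ)`; a proper non-zero subrepresentation has a one-dimensional Jacquet module -/

set_option synthInstance.maxHeartbeats 400000 in  -- instance paths on the CM carrier `∏_{w ∣ v} L_w` (as ★ `finiteDimensional_finrank_coinvariants_cmPrincipalSeries_two_le_two`)
set_option maxHeartbeats 2000000 in  -- the `rfl`-bridge `cmPrincipalSeries L 2 v χ = normalizedInd (cmBorelTriple L 2 v) (𝟙 ⊗ χ)` (cf. the ★ inputs, 2 M each)
/-- **NO CHAIN `⊥ < N₁ < N₂ < ⊤` IN `i_G(χ)` ON `U(Φ₂)(L⁺_v)`, `v` NON-SPLIT, EVERY `χ`** (its length is at most `2`): the Jacquet rank `dim r_{B₂}(·) ≤ 2` (★) is strictly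
monotone along chains because every constituent has `r_{B₂} ≠ 0` (★ (H3)₂). [cite: Casselman1995, Cor. 7.1.2] [cite: BernsteinZelevinsky1977, Thm. 2.8] -/
theorem not_bot_lt_lt_lt_top_cmPrincipalSeries_two (hns : ∀ w : PlacesOver L v, IsCMField.complexConj L • w.1 = w.1)
    (χ : ↥(cmBorelTriple L 2 v).M →* ℂˣ)
    (N₁ N₂ : Subrepresentation (haveI := locallyCompactSpace_cmBorelU L 2 v; cmPrincipalSeries L 2 v χ)) :
    ¬ (⊥ < N₁ ∧ N₁ < N₂ ∧ N₂ < ⊤) := by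
  haveI := locallyCompactSpace_cmBorelU L 2 v
  have hfd := (F0P3bU2PrincipalSeriesJacquetRankLeTwo.finiteDimensional_finrank_coinvariants_cmPrincipalSeries_two_le_two L v hns χ).1
  have h2 := (F0P3bU2PrincipalSeriesJacquetRankLeTwo.finiteDimensional_finrank_coinvariants_cmPrincipalSeries_two_le_two L v hns χ).2
  haveI := hfd
  exact Representation.not_bot_lt_lt_lt_top_of_finrank_coinvariants_le_two (cmBorelTriple L 2 v) (isLimitOfCompactOpen_cmBorelTriple_N L 2 v)
    (K2E3LocalIrrepCuspidalOrPrincipalTwo.isSmooth_cmPrincipalSeries L 2 v χ) (F0P3bHPrincipalSeriesJHHolds.hHC_holds L v hns χ) h2 N₁ N₂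

/-! ## §3 The Jacquet filtration of `i_G(χ)` for an arbitrary continuous `χ` -/

set_option synthInstance.maxHeartbeats 400000 in  -- instance paths on the CM carrier (as ★ (N1)₂)
set_option maxHeartbeats 8000000 in  -- the `have` of ★ (N1)₂ costs its consumers 8 M (as ★ `u2PrincipalSeries_jacquet_trace`); the transport is a variable substitution
/-- **THE JACQUET FILTRATION OF `i_G(χ)` ON `U(Φ₂)(L⁺_v)` AT A NON-SPLIT PLACE, EVERY CONTINUOUS `χ`** ([Casselman1995] Lemma 7.1.1 (a) for `U(1,1)`): `r_{B₂} i_G(χ)` is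
finite-dimensional of dimension `2` and has a LINE `ℓ` on which `T₂(L⁺_v)` acts by `wχ = w(χ ∘ ι₂, 1)` (`= χ(w₀ · w₀⁻¹)`, §1) and modulo which it acts by `χ` — ★ (N1)₂ read
through §1 `χ = (χ ∘ ι₂, 1)`. [cite: Casselman1995, Lemma 7.1.1 (a) p. 67; §6.3] [cite: BernsteinZelevinsky1977, §2.12, Cor. 2.13 (c)] [cite: Rogawski1990, §12.1 p. 171] -/
theorem jacquetFiltration_cmPrincipalSeries_two (hns : ∀ w : PlacesOver L v, IsCMField.complexConj L • w.1 = w.1)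
    (χ : ↥(cmBorelTriple L 2 v).M →* ℂˣ) (hχ : Continuous fun t => ((χ t : ℂˣ) : ℂ)) :
    haveI := locallyCompactSpace_cmBorelU L 2 v
    FiniteDimensional ℂ ((cmBorelTriple L 2 v).restrict (cmPrincipalSeries L 2 v χ)).Coinvariants ∧
    Module.finrank ℂ ((cmBorelTriple L 2 v).restrict (cmPrincipalSeries L 2 v χ)).Coinvariants = 2 ∧
    ∃ ℓ : Submodule ℂ ((cmBorelTriple L 2 v).restrict (cmPrincipalSeries L 2 v χ)).Coinvariants,
      Module.finrank ℂ ↥ℓ = 1 ∧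
      (∀ (m : ↥(cmBorelTriple L 2 v).M), ∀ x ∈ ℓ,
        (cmPrincipalSeries L 2 v χ).normalizedJacquet (cmBorelTriple L 2 v) m x =
          ((weylTorusCharPair (conjLocal L (IsCMField.complexConj L) v) (cmLocalForm L 2 v) (cmLocalForm_eq_over L 2 v) 0 (χ.comp (torusChartHom₂ L v)) 1 m : ℂˣ) : ℂ) • x) ∧
      (∀ (m : ↥(cmBorelTriple L 2 v).M) (x : ((cmBorelTriple L 2 v).restrict (cmPrincipalSeries L 2 v χ)).Coinvariants),
        (cmPrincipalSeries L 2 v χ).normalizedJacquet (cmBorelTriple L 2 v) m x - ((χ m : ℂˣ) : ℂ) • x ∈ ℓ) := by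
  haveI := locallyCompactSpace_cmBorelU L 2 v
  have h1c : Continuous fun x : ↥(normOneUnits (conjLocal L (IsCMField.complexConj L) v)) =>
      (((1 : ↥(normOneUnits (conjLocal L (IsCMField.complexConj L) v)) →* ℂˣ) x : ℂˣ) : ℂ) := by
    simp only [MonoidHom.one_apply, Units.val_one]
    exact continuous_const
  have h := F0P3cU2PrincipalSeriesJacquetFiltration.u2PrincipalSeries_jacquetFiltration L v hns (χ.comp (torusChartHom₂ L v)) 1
    (continuous_comp_torusChartHom₂ L v χ hχ) h1c
  -- transport along `(χ ∘ ι₂, 1) = χ` by substituting a VARIABLE (no rewriting inside dependent types)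
  suffices H : ∀ ψ : ↥(cmBorelTriple L 2 v).M →* ℂˣ,
      torusCharPair (conjLocal L (IsCMField.complexConj L) v) (cmLocalForm L 2 v) (cmLocalForm_eq_over L 2 v) 0 (χ.comp (torusChartHom₂ L v)) 1 = ψ →
      (FiniteDimensional ℂ ((cmBorelTriple L 2 v).restrict (cmPrincipalSeries L 2 v ψ)).Coinvariants ∧
      Module.finrank ℂ ((cmBorelTriple L 2 v).restrict (cmPrincipalSeries L 2 v ψ)).Coinvariants = 2 ∧
      ∃ ℓ : Submodule ℂ ((cmBorelTriple L 2 v).restrict (cmPrincipalSeries L 2 v ψ)).Coinvariants,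
        Module.finrank ℂ ↥ℓ = 1 ∧
        (∀ (m : ↥(cmBorelTriple L 2 v).M), ∀ x ∈ ℓ,
          (cmPrincipalSeries L 2 v ψ).normalizedJacquet (cmBorelTriple L 2 v) m x =
            ((weylTorusCharPair (conjLocal L (IsCMField.complexConj L) v) (cmLocalForm L 2 v) (cmLocalForm_eq_over L 2 v) 0 (χ.comp (torusChartHom₂ L v)) 1 m : ℂˣ) : ℂ) • x) ∧
        (∀ (m : ↥(cmBorelTriple L 2 v).M) (x : ((cmBorelTriple L 2 v).restrict (cmPrincipalSeries L 2 v ψ)).Coinvariants),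
          (cmPrincipalSeries L 2 v ψ).normalizedJacquet (cmBorelTriple L 2 v) m x - ((ψ m : ℂˣ) : ℂ) • x ∈ ℓ)) from
    H χ (torusCharPair_comp_torusChartHom₂_eq L v χ)
  rintro ψ rfl
  exact h

set_option synthInstance.maxHeartbeats 400000 in  -- instance paths on the CM carrier
set_option maxHeartbeats 2000000 in  -- the `rfl`-bridge `cmPrincipalSeries = normalizedInd` (as §2)
/-- **A PROPER NON-ZERO SUBREPRESENTATION OF `i_G(χ)` HAS A ONE-DIMENSIONAL JACQUET MODULE** (`χ` continuous, `v` non-split): `0 < dim r(N) < dim r(i_G(χ)) = 2`.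
[cite: Casselman1995, Prop. 7.1.3 p. 67] [cite: BernsteinZelevinsky1977, Thm. 2.8] -/
theorem finrank_restrict_eq_one_of_ne_bot_of_ne_top_two (hns : ∀ w : PlacesOver L v, IsCMField.complexConj L • w.1 = w.1)
    (χ : ↥(cmBorelTriple L 2 v).M →* ℂˣ) (hχ : Continuous fun t => ((χ t : ℂˣ) : ℂ))
    {N : Subrepresentation (haveI := locallyCompactSpace_cmBorelU L 2 v; cmPrincipalSeries L 2 v χ)} (hbot : N ≠ ⊥) (htop : N ≠ ⊤) :
    Module.finrank ℂ ((cmBorelTriple L 2 v).restrict N.toRepresentation).Coinvariants = 1 := by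
  haveI := locallyCompactSpace_cmBorelU L 2 v
  have hfd := (jacquetFiltration_cmPrincipalSeries_two L v hns χ hχ).1
  have h2 := (jacquetFiltration_cmPrincipalSeries_two L v hns χ hχ).2.1
  haveI := hfd
  exact Representation.finrank_coinvariants_eq_one_of_ne_bot_of_ne_top (cmBorelTriple L 2 v) (isLimitOfCompactOpen_cmBorelTriple_N L 2 v)
    (K2E3LocalIrrepCuspidalOrPrincipalTwo.isSmooth_cmPrincipalSeries L 2 v χ) (F0P3bHPrincipalSeriesJHHolds.hHC_holds L v hns χ) h2 hbot htop

end Summit.HodgeConjecture.HodgeConjecture.Cruxes.H413.K2E3U2PrincipalSeriesNoThreeChain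

end
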